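import Summits.CriticalPhenomena.PercolationContinuityZ3.Theorems.PercNearOneGluingNoHeavyPcintBSMXSiteAssembly
import Summits.CriticalPhenomena.PercolationContinuityZ3.Theorems.PercNearOneGluingNoHeavyPcintBSMRAssembly
import HarnessLib

/-!
# PCINT lane, PHASE 9 (block renewal with reach-`m` pieces), SITE version: the site certificate theorem

Cell `prim-pcint`, seat `prim-pcint-1` (gen 17); memo `run/shared/lean/prim/pcint/T-FIBRE-ROUTE.md` §PHASE 9.

**`BSMR.siteCriticalProb_le_of_certV`**, the reach-`m` analogue of `BSMX.siteCriticalProb_le_of_cert5V`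
(…PcintBSMXSiteAssembly): same block words and pair-offset chain as the bond version (…PcintBSMRAssembly), reward
= shared VERTICES of same-level blocks (`BSMX.RlocV`, transverse count `BSMX.SV` in both time-axis branches,
functional `BSMX.certLHSV`), vertex keys in the reach-`m` cube (`BSMR.VertCube`), rewards on `[-2m,2m]^t`,
potentials on `[-4m,4m]^t`.  The probabilistic ending (`BSMX.le_real_exitEventV`, `tendsto_siteTheta`) is reused.
-/

noncomputable section

namespace Summit.CriticalPhenomena.PercolationContinuityZ3.Theorems.Pcint.BSMR

open Finset Filter Topology OSM BSM BSMX MeasureTheory Literature.Probability.Percolation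
  Literature.Probability.LatticeModels

variable {m t k np : ℕ}

/-- **Vertex keys in the reach-`m` cube**: every entered vertex of a piece has coordinates in `[-m, m]`. -/
def VertCube (m : ℕ) (pc : Fin np → List (Fin t × Bool)) (k : ℕ) : Prop :=
  ∀ σ, ∀ q ∈ tverts k 0 (pc σ), ∀ i, -(m : ℤ) ≤ q.2 i ∧ q.2 i ≤ m

/-- All vertex keys of a block lie in the reach-`m` cube. -/
theorem vert_cube {pc : Fin np → List (Fin t × Bool)} (hvc : VertCube m pc k) (b : Blk np k)
    {q : VKey t k} (hq : q ∈ Vst pc b) (i : Fin t) : -(m : ℤ) ≤ q.2 i ∧ q.2 i ≤ m := by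
  rw [Vst, mem_insert] at hq
  rcases hq with rfl | hq
  · simp
  · exact hvc b.1 q hq i

/-- The site rewards vanish outside `{0} × [-2m,2m]^t`. -/
theorem mem_box_of_RlocV_ne_zero {pc : Fin np → List (Fin t × Bool)} (hvc : VertCube m pc k)
    {o : Off t k} {b b' : Blk np k} (h : RlocV pc o b b' ≠ 0) :
    o ∈ (Box t (2 * m)).image (fun y => ((0 : Fin k → ℤ), y)) := by
  rw [mem_image]
  refine ⟨o.2, ?_, Prod.ext (fst_eq_zero_of_RlocV_ne_zero pc h).symm rfl⟩
  obtain ⟨q, hq, q', hq', hqq⟩ := exists_of_RlocV_ne_zero pc h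
  rw [mem_Box]
  intro i
  have h1 := vert_cube hvc b hq i
  have h2 := vert_cube hvc b' hq' i
  have : o.2 i = q.2 i - q'.2 i := by rw [hqq]; simp
  rw [this]
  push_cast
  constructor <;> linarith [h1.1, h1.2, h2.1, h2.2]

/-- **The pair estimate** (site). -/
theorem pair_sum_leV (hk : 2 ≤ k) {pc : Fin np → List (Fin t × Bool)} {w : Fin np → ℝ} {g : Fin (2 * m + 1) → ℝ}
    (hg : LawOK m g) (hc : Cube m pc) (hm : Marg m pc w g) (hw : ∀ σ, 0 ≤ w σ) {x : ℝ} (hx : 1 ≤ x)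
    {N : ℕ} {T : ℝ} (hT : TailBoundH t k m g N T) (c : ℝ) (φ : (Fin t → ℤ) → ℝ) (hφ : ∀ y, 0 ≤ φ y)
    {V0f V1f : (Fin t → ℤ) → ℝ}
    (hV0 : ∀ u ∈ Box t (4 * m), V0H k m g N T c φ u ≤ V0f u)
    (hV1 : ∀ u ∈ Box t (4 * m), V1H k m g N T c φ u ≤ V1f u) (n : ℕ)
    {y : Fin t → ℤ} (hy : y ∈ Box t (2 * m)) (σ σ' : Fin np) :
    ∑ a : Fin k, ∑ a' : Fin k, νw k w (σ, a) * νw k w (σ', a') *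
        (x ^ RlocV pc ((0 : Fin k → ℤ), y) (σ, a) (σ', a') - 1) *
          (c + ∑ z ∈ Box t (2 * m), Gm pc (νw k w) n ((((0 : Fin k → ℤ), y) : Off t k) + δ pc (σ, a) (σ', a')) (0, z) * φ z) ≤
      w σ * w σ' * ((1 / (k : ℝ)) * (x ^ SV pc k y σ σ' - 1) * V0f (y + (pend (pc σ') - pend (pc σ))) +
        ((k : ℝ) - 1) / k * (x ^ SV pc k y σ σ' - 1) * V1f (y + (pend (pc σ') - pend (pc σ)))) := by
  have hk0 : 0 < k := by omega
  have hu4 : y + (pend (pc σ') - pend (pc σ)) ∈ Box t (4 * m) := mem_Box4 hc hy σ σ'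
  have hkR : (0 : ℝ) < k := by exact_mod_cast hk0
  set uo : Fin t → ℤ := y + (pend (pc σ') - pend (pc σ)) with huo
  set Sv : ℕ := SV pc k y σ σ' with hSv
  set K : ℝ := w σ * w σ' / (k : ℝ) ^ 2 with hK
  have hK0 : 0 ≤ K := by rw [hK]; exact div_nonneg (mul_nonneg (hw σ) (hw σ')) (by positivity)
  have hxS : 0 ≤ x ^ Sv - 1 := sub_nonneg.2 (one_le_pow₀ hx)
  set Gz : Fin k → Fin k → (Fin t → ℤ) → ℝ := fun a a' z => Gm pc (νw k w) n (e a' - e a, uo) (0, z) with hGz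
  set Dval : ℝ := K * (x ^ Sv - 1) * (c + ∑ z ∈ Box t (2 * m), Gm pc (νw k w) n (0, uo) (0, z) * φ z) with hD
  set Oterm : Fin k → Fin k → ℝ := fun a a' => K * (x ^ Sv - 1) * (c + ∑ z ∈ Box t (2 * m), Gz a a' z * φ z) with hO
  have hterm : ∀ a a' : Fin k, νw k w (σ, a) * νw k w (σ', a') *
      (x ^ RlocV pc ((0 : Fin k → ℤ), y) (σ, a) (σ', a') - 1) *
        (c + ∑ z ∈ Box t (2 * m), Gm pc (νw k w) n ((((0 : Fin k → ℤ), y) : Off t k) + δ pc (σ, a) (σ', a')) (0, z) * φ z) =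
      if a = a' then Dval else Oterm a a' := by
    intro a a'
    rw [RlocV_zero, offset_pair]
    have hνν : νw k w (σ, a) * νw k w (σ', a') = K := by simp only [νw, hK]; ring
    rw [hνν]
    by_cases haa : a = a'
    · subst haa
      rw [if_pos rfl, hD, sub_self]
    · rw [if_neg haa, hO]
  simp_rw [hterm]
  have hsplit : ∑ a : Fin k, ∑ a' : Fin k, (if a = a' then Dval else Oterm a a') =
      (k : ℝ) * Dval + ∑ a : Fin k, ∑ a' : Fin k, (if a = a' then 0 else Oterm a a') := by
    have : ∀ a a' : Fin k, (if a = a' then Dval else Oterm a a') =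
        (if a = a' then Dval else 0) + (if a = a' then 0 else Oterm a a') := by
      intro a a'; split_ifs <;> simp
    simp_rw [this, sum_add_distrib, sum_ite_eq, if_pos (mem_univ _), sum_const, card_univ, Fintype.card_fin,
      nsmul_eq_mul]
  rw [hsplit]
  have hdiag : (k : ℝ) * Dval ≤ w σ * w σ' * ((1 / (k : ℝ)) * (x ^ Sv - 1) * V0f uo) := by
    have hG : c + ∑ z ∈ Box t (2 * m), Gm pc (νw k w) n (0, uo) (0, z) * φ z ≤ V0f uo := by
      refine le_trans ?_ (hV0 uo hu4)
      unfold V0H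
      refine add_le_add le_rfl (sum_le_sum fun z _ => mul_le_mul_of_nonneg_right ?_ (hφ z))
      rw [Gm_zero_eq hg hc hm hk0]
      exact (hT.2 n (z - uo)).1
    calc (k : ℝ) * Dval = (k : ℝ) * (K * (x ^ Sv - 1)) *
          (c + ∑ z ∈ Box t (2 * m), Gm pc (νw k w) n (0, uo) (0, z) * φ z) := by rw [hD]; ring
      _ ≤ (k : ℝ) * (K * (x ^ Sv - 1)) * V0f uo :=
          mul_le_mul_of_nonneg_left hG (mul_nonneg hkR.le (mul_nonneg hK0 hxS))
      _ = w σ * w σ' * ((1 / (k : ℝ)) * (x ^ Sv - 1) * V0f uo) := by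
          rw [hK]; field_simp
  have hoff : ∑ a : Fin k, ∑ a' : Fin k, (if a = a' then 0 else Oterm a a') ≤
      w σ * w σ' * (((k : ℝ) - 1) / k * (x ^ Sv - 1) * V1f uo) := by
    have e1 : ∑ a : Fin k, ∑ a' : Fin k, (if a = a' then 0 else Oterm a a') =
        K * (x ^ Sv - 1) * ∑ a : Fin k, ∑ a' : Fin k,
          (if a = a' then 0 else (c + ∑ z ∈ Box t (2 * m), Gz a a' z * φ z)) := by
      rw [mul_sum]; refine sum_congr rfl fun a _ => ?_
      rw [mul_sum]; refine sum_congr rfl fun a' _ => ?_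
      rw [hO]; split_ifs <;> simp
    have e2 : ∑ a : Fin k, ∑ a' : Fin k, (if a = a' then 0 else (c + ∑ z ∈ Box t (2 * m), Gz a a' z * φ z)) =
        ((k : ℝ) ^ 2 - k) * c + ∑ z ∈ Box t (2 * m), φ z *
          ∑ a : Fin k, ∑ a' : Fin k, (if a = a' then 0 else Gm pc (νw k w) n (e a' - e a, uo) (0, z)) := by
      have : ∀ a a' : Fin k, (if a = a' then (0 : ℝ) else (c + ∑ z ∈ Box t (2 * m), Gz a a' z * φ z)) =
          (if a = a' then (0 : ℝ) else c) + ∑ z ∈ Box t (2 * m), φ z * (if a = a' then 0 else Gz a a' z) := by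
        intro a a'
        split_ifs
        · simp
        · rw [add_left_cancel_iff.2 (sum_congr rfl fun z _ => mul_comm _ _)]
      simp_rw [this, sum_add_distrib]
      congr 1
      · have hc' : ∀ a a' : Fin k, (if a = a' then (0 : ℝ) else c) = c - (if a = a' then c else 0) := by
          intro a a'; split_ifs <;> ring
        simp_rw [hc', sum_sub_distrib, sum_ite_eq, if_pos (mem_univ _), sum_const, card_univ, Fintype.card_fin,
          nsmul_eq_mul]
        ring
      · rw [← Fintype.sum_prod_type', sum_comm]
        refine sum_congr rfl fun z _ => ?_
        rw [← Fintype.sum_prod_type', ← mul_sum]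
    have e3 : ∀ z : Fin t → ℤ, ∑ a : Fin k, ∑ a' : Fin k,
        (if a = a' then 0 else Gm pc (νw k w) n (e a' - e a, uo) (0, z)) ≤
          (k : ℝ) * ((k : ℝ) - 1) * (G1H k m g N (z - uo) + T) := by
      intro z
      rw [sum_Gm_adj_eq hg hc hm hk0]
      have hk1 : (0 : ℝ) < (k : ℝ) * ((k : ℝ) - 1) := by
        have : (2 : ℝ) ≤ k := by exact_mod_cast hk
        nlinarith
      have hre : ∑ i ∈ range n, ((k : ℝ) ^ 2 * u k (i + 1) - k * u k i) * ∏ l, H m g (2 * i) (z l - uo l) =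
          (k : ℝ) * ((k : ℝ) - 1) * ∑ i ∈ range n, cadj k i * ∏ l, H m g (2 * i) ((z - uo) l) := by
        rw [mul_sum]
        refine sum_congr rfl fun i _ => ?_
        have hk1' : (k : ℝ) - 1 ≠ 0 := by
          have : (2 : ℝ) ≤ k := by exact_mod_cast hk
          intro h; linarith
        have hkk : (k : ℝ) ≠ 0 := ne_of_gt hkR
        have hp : ∏ l, H m g (2 * i) ((z - uo) l) = ∏ l, H m g (2 * i) (z l - uo l) := rfl
        rw [hp, cadj]
        field_simp
      rw [hre]
      exact mul_le_mul_of_nonneg_left (hT.2 n (z - uo)).2 hk1.le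
    have hk1 : (0 : ℝ) ≤ (k : ℝ) * ((k : ℝ) - 1) := by
      have : (2 : ℝ) ≤ k := by exact_mod_cast hk
      nlinarith
    have e4 : ((k : ℝ) ^ 2 - k) * c + ∑ z ∈ Box t (2 * m), φ z *
        ∑ a : Fin k, ∑ a' : Fin k, (if a = a' then 0 else Gm pc (νw k w) n (e a' - e a, uo) (0, z)) ≤
        (k : ℝ) * ((k : ℝ) - 1) * V1f uo := by
      refine le_trans ?_ (mul_le_mul_of_nonneg_left (hV1 uo hu4) hk1)
      unfold V1H
      rw [mul_add, mul_sum]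
      refine add_le_add (by nlinarith) (sum_le_sum fun z _ => ?_)
      calc φ z * ∑ a : Fin k, ∑ a' : Fin k, (if a = a' then 0 else Gm pc (νw k w) n (e a' - e a, uo) (0, z))
          ≤ φ z * ((k : ℝ) * ((k : ℝ) - 1) * (G1H k m g N (z - uo) + T)) :=
            mul_le_mul_of_nonneg_left (e3 z) (hφ z)
        _ = (k : ℝ) * ((k : ℝ) - 1) * ((G1H k m g N (z - uo) + T) * φ z) := by ring
    rw [e1, e2]
    calc K * (x ^ Sv - 1) * (((k : ℝ) ^ 2 - k) * c + ∑ z ∈ Box t (2 * m), φ z *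
          ∑ a : Fin k, ∑ a' : Fin k, (if a = a' then 0 else Gm pc (νw k w) n (e a' - e a, uo) (0, z)))
        ≤ K * (x ^ Sv - 1) * ((k : ℝ) * ((k : ℝ) - 1) * V1f uo) :=
          mul_le_mul_of_nonneg_left e4 (mul_nonneg hK0 hxS)
      _ = w σ * w σ' * (((k : ℝ) - 1) / k * (x ^ Sv - 1) * V1f uo) := by rw [hK]; field_simp
  calc (k : ℝ) * Dval + ∑ a : Fin k, ∑ a' : Fin k, (if a = a' then 0 else Oterm a a')
      ≤ w σ * w σ' * ((1 / (k : ℝ)) * (x ^ Sv - 1) * V0f uo) +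
        w σ * w σ' * (((k : ℝ) - 1) / k * (x ^ Sv - 1) * V1f uo) := add_le_add hdiag hoff
    _ = _ := by ring

/-- **The site certificate theorem of PHASE 9**: a passed site certificate gives `p_c^site(ℤ^{k+t}) ≤ p`. -/
theorem siteCriticalProb_le_of_certV (hk : 2 ≤ k) {pc : Fin np → List (Fin t × Bool)} {w : Fin np → ℝ}
    {g : Fin (2 * m + 1) → ℝ} (hg : LawOK m g) (hcube : Cube m pc) (hvc : VertCube m pc k) (hm : Marg m pc w g)
    (hw : ∀ σ, 0 ≤ w σ) {p : ℝ} (hp0 : 0 < p) (hp1 : p ≤ 1) {N : ℕ} {T : ℝ} (hT : TailBoundH t k m g N T)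
    {c : ℝ} (hc : 0 < c) (φ : (Fin t → ℤ) → ℝ) (hφ : ∀ y, 0 ≤ φ y) {V0f V1f : (Fin t → ℤ) → ℝ}
    (hV0 : ∀ u ∈ Box t (4 * m), V0H k m g N T c φ u ≤ V0f u)
    (hV1 : ∀ u ∈ Box t (4 * m), V1H k m g N T c φ u ≤ V1f u)
    (hcert : ∀ y ∈ Box t (2 * m), certLHSV pc w k (1 / p) V0f V1f y ≤ φ y) :
    siteCriticalProb (zdGraph (k + t)) (0 : Site (k + t)) ≤ p := by
  have hk0 : 0 < k := by omega
  have hx : 1 ≤ 1 / p := by rw [le_div_iff₀ hp0]; linarith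
  have hν0 : ∀ b : Blk np k, 0 ≤ νw k w b := fun b => div_nonneg (hw b.1) (Nat.cast_nonneg k)
  have hν1 : ∑ b : Blk np k, νw k w b = 1 := sum_νw hk0 (sum_w_of_marg hg hm)
  set B : Finset (Off t k) := (Box t (2 * m)).image (fun y => ((0 : Fin k → ℤ), y)) with hB
  have hsumB : ∀ f : Off t k → ℝ, ∑ z ∈ B, f z = ∑ y ∈ Box t (2 * m), f ((0 : Fin k → ℤ), y) := by
    intro f
    rw [hB, sum_image]
    intro y _ y' _ h
    exact (Prod.mk.inj h).2
  have hcert' : ∀ n, ∀ o ∈ B, ∑ b : Blk np k, ∑ b' : Blk np k,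
      νw k w b * νw k w b' * ((1 / p) ^ RlocV pc o b b' - 1) *
        (c + ∑ z ∈ B, Gm pc (νw k w) n (o + δ pc b b') z * φ z.2) ≤ φ o.2 := by
    intro n o ho
    obtain ⟨y, hy, rfl⟩ := mem_image.1 ho
    simp_rw [hsumB]
    simp only [Fintype.sum_prod_type]
    calc ∑ σ : Fin np, ∑ a : Fin k, ∑ σ' : Fin np, ∑ a' : Fin k, νw k w (σ, a) * νw k w (σ', a') *
          ((1 / p) ^ RlocV pc ((0 : Fin k → ℤ), y) (σ, a) (σ', a') - 1) *
            (c + ∑ z ∈ Box t (2 * m), Gm pc (νw k w) n ((((0 : Fin k → ℤ), y) : Off t k) + δ pc (σ, a) (σ', a'))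
              ((0 : Fin k → ℤ), z) * φ z)
        = ∑ σ : Fin np, ∑ σ' : Fin np, ∑ a : Fin k, ∑ a' : Fin k, νw k w (σ, a) * νw k w (σ', a') *
          ((1 / p) ^ RlocV pc ((0 : Fin k → ℤ), y) (σ, a) (σ', a') - 1) *
            (c + ∑ z ∈ Box t (2 * m), Gm pc (νw k w) n ((((0 : Fin k → ℤ), y) : Off t k) + δ pc (σ, a) (σ', a'))
              ((0 : Fin k → ℤ), z) * φ z) := sum_congr rfl fun σ _ => sum_comm
      _ ≤ certLHSV pc w k (1 / p) V0f V1f y :=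
          sum_le_sum fun σ _ => sum_le_sum fun σ' _ =>
            pair_sum_leV hk hg hcube hm hw hx hT c φ hφ hV0 hV1 n hy σ σ'
      _ ≤ φ y := hcert y hy
  have hV0ge : ∀ n, c + ∑ z ∈ B, Gm pc (νw k w) n 0 z * φ z.2 ≤ V0H k m g N T c φ 0 := by
    intro n
    rw [hsumB]
    unfold V0H
    refine add_le_add le_rfl (sum_le_sum fun z _ => mul_le_mul_of_nonneg_right ?_ (hφ z))
    have h0 : (0 : Off t k) = ((0 : Fin k → ℤ), (0 : Fin t → ℤ)) := rfl
    rw [h0, Gm_zero_eq hg hcube hm hk0]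
    exact (hT.2 n (z - 0)).1
  have hA : ∀ n, A (RlocV pc) pc (νw k w) (1 / p) n 0 ≤ V0H k m g N T c φ 0 / c := fun n =>
    (A_le_of_cert' (RlocV pc) pc hν0 hν1 hx B (fun o b b' h => mem_box_of_RlocV_ne_zero hvc h)
      (φ := fun o => φ o.2) (fun z _ => hφ z.2) hc hcert' n).trans (div_le_div_of_nonneg_right (hV0ge n) hc.le)
  have hV0 : 0 < V0H k m g N T c φ 0 := by
    have := hV0ge 0
    have h2 : 0 ≤ ∑ z ∈ B, Gm pc (νw k w) 0 0 z * φ z.2 :=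
      sum_nonneg fun z _ => mul_nonneg (sum_nonneg fun i _ => Pn_nonneg pc hν0 i _ _) (hφ z.2)
    linarith
  set pI : unitInterval := ⟨p, hp0.le, hp1⟩
  have hball : ∀ n : ℕ, c / V0H k m g N T c φ 0 ≤ (sitePercolation (Site (k + t)) pI).real
      (exitEvent (zdGraph (k + t)) (DCTQ.ball (zdGraph (k + t)) (0 : Site (k + t)) n) (0 : Site (k + t))) := by
    intro n
    refine le_trans ?_ (le_real_exitEventV pc hν0 hν1 pI hp0 n)
    have hApos : 0 < A (RlocV pc) pc (νw k w) (1 / p) (n + 2) 0 :=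
      lt_of_lt_of_le one_pos (one_le_A (RlocV pc) pc hν0 hν1 hx (n + 2) 0)
    calc c / V0H k m g N T c φ 0 = 1 / (V0H k m g N T c φ 0 / c) := by rw [one_div_div]
      _ ≤ 1 / A (RlocV pc) pc (νw k w) (1 / p) (n + 2) 0 := one_div_le_one_div_of_le hApos (hA (n + 2))
  have hmono : Monotone (fun j : ℕ => DCTQ.ball (zdGraph (k + t)) (0 : Site (k + t)) j) := fun a b hab =>
    DCTQ.ball_mono 0 hab
  have hex : ∀ v : Site (k + t), ∃ j, v ∈ DCTQ.ball (zdGraph (k + t)) (0 : Site (k + t)) j := fun v => by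
    obtain ⟨q⟩ := zdGraph_preconnected_holds (d := k + t) (0 : Site (k + t)) v
    exact ⟨q.length, DCTQ.mem_ball_of_walk q le_rfl⟩
  have h00 : (0 : Site (k + t)) ∈ DCTQ.ball (zdGraph (k + t)) (0 : Site (k + t)) 0 := DCTQ.mem_ball_self _ _
  have hlim := tendsto_siteTheta (G := zdGraph (k + t)) hmono hex h00 pI
  have heq : ∀ j : ℕ, (⋂ i ≤ j, exitEvent (zdGraph (k + t)) (DCTQ.ball (zdGraph (k + t)) (0 : Site (k + t)) i)
      (0 : Site (k + t))) = exitEvent (zdGraph (k + t)) (DCTQ.ball (zdGraph (k + t)) (0 : Site (k + t)) j)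
        (0 : Site (k + t)) := by
    intro j
    apply Set.Subset.antisymm
    · intro ω hω; exact (Set.mem_iInter₂.1 hω) j le_rfl
    · exact Set.subset_iInter₂ fun i hi => exitEvent_anti (hmono hi) (DCTQ.mem_ball_self _ _)
  simp_rw [heq] at hlim
  have hθ : c / V0H k m g N T c φ 0 ≤ siteTheta (zdGraph (k + t)) (0 : Site (k + t)) pI := ge_of_tendsto' hlim hball
  have hθpos : 0 < siteTheta (zdGraph (k + t)) (0 : Site (k + t)) pI := lt_of_lt_of_le (div_pos hc hV0) hθ
  exact SiteOrbitQuotient.siteCriticalProb_le_of_siteTheta_pos (zdGraph (k + t)) 0 pI hθpos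

end Summit.CriticalPhenomena.PercolationContinuityZ3.Theorems.Pcint.BSMR

end
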